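import Mathlib.Analysis.SpecificLimits.Normed
import Mathlib.Analysis.Complex.Basic
import Literature.Analysis.Fourier.HilbertTransformCircleSeries
import HarnessLib

/-!
# The Poisson kernel and the conjugate Poisson kernel on the circle; `H P_ρ = Q_ρ`; the Möbius angle map

Topic `Literature/Analysis/Fourier`. For `|ρ| < 1` the **Poisson kernel** of the unit disc restricted to the circle and its
**conjugate** are

  `P_ρ(y) = (1 − ρ²)/(1 − 2ρ cos y + ρ²) = 1 + 2 Σ_{k ≥ 1} ρᵏ cos ky`,
  `Q_ρ(y) = 2ρ sin y/(1 − 2ρ cos y + ρ²) = 2 Σ_{k ≥ 1} ρᵏ sin ky`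

[cite: Grafakos2014, Ex. 4.1.4 (Poisson and conjugate Poisson kernels on `𝕋¹`)]. We prove both series in closed form from the
complex geometric series `Σ (ρe^{iy})ᵏ`, and deduce with the tree's mode-by-mode theorem
`Literature.Analysis.Fourier.hilbertTransformCircle_tsum` that the periodic Hilbert transform (multiplier `−i sgn k`,
`H cos k· = sin k·`) maps `P_ρ` to `Q_ρ`:

* `hilbertTransformCircle_poissonKernelCircle : hilbertTransformCircle (poissonKernelCircle ρ) x = conjPoissonKernelCircle ρ x`.

The Möbius angle map `2 arctan(s tan(y/2))` whose derivative IS `P_ρ` (`ρ = (s−1)/(s+1)`) — the change of variables of conformally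
adapted periodic collocation — lives summit-side (`Summits/NavierStokesRegularity/OSWSelfSimilar/MoebiusAdaptedCircleMap.lean`), being
our engine's ingredient rather than a cited statement; the conformal covariance of the conjugate function itself is NOT proved here.
-/

namespace Literature.Analysis.Fourier

open _root_.Complex Filter
open scoped Real Topology

/-! ### Definitions and the denominator -/

/-- The Poisson kernel of the unit disc on the boundary circle, `P_ρ(y) = (1 − ρ²)/(1 − 2ρ cos y + ρ²)`.
[cite: Grafakos2014, Ex. 4.1.4 (Poisson kernel on `𝕋¹`)] -/
noncomputable def poissonKernelCircle (ρ y : ℝ) : ℝ :=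
  (1 - ρ ^ 2) / (1 - 2 * ρ * Real.cos y + ρ ^ 2)

/-- The conjugate Poisson kernel on the circle, `Q_ρ(y) = 2ρ sin y/(1 − 2ρ cos y + ρ²)`.
[cite: Grafakos2014, Ex. 4.1.4 (conjugate Poisson kernel on `𝕋¹`)] -/
noncomputable def conjPoissonKernelCircle (ρ y : ℝ) : ℝ :=
  2 * ρ * Real.sin y / (1 - 2 * ρ * Real.cos y + ρ ^ 2)

/-- The common denominator is positive: `1 − 2ρ cos y + ρ² = |1 − ρe^{iy}|² ≥ (1 − |ρ|)² > 0` for `|ρ| < 1` (so `P_ρ > 0`).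
[cite: Grafakos2014, Ex. 4.1.4 (positivity of the Poisson kernel on `𝕋¹`)] -/
theorem poissonDenom_pos {ρ : ℝ} (hρ : |ρ| < 1) (y : ℝ) : 0 < 1 - 2 * ρ * Real.cos y + ρ ^ 2 := by
  have hc : |Real.cos y| ≤ 1 := Real.abs_cos_le_one y
  have h1 : |ρ * Real.cos y| ≤ |ρ| := by
    rw [abs_mul]
    exact mul_le_of_le_one_right (abs_nonneg ρ) hc
  have h2 : ρ * Real.cos y ≤ |ρ| := le_trans (le_abs_self _) h1
  have h3 : ρ ^ 2 = |ρ| ^ 2 := (sq_abs ρ).symm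
  nlinarith [abs_nonneg ρ]

/-! ### The geometric Fourier series in closed form -/

/-- Real part bookkeeping: with `z = ρ·e^{iy}`, `(z/(1 − z)).re = (ρ cos y − ρ²)/(1 − 2ρ cos y + ρ²)` and
`(z/(1 − z)).im = ρ sin y/(1 − 2ρ cos y + ρ²)`. [folklore] -/
private theorem geometricRatio_re_im {ρ : ℝ} (hρ : |ρ| < 1) (y : ℝ) :
    (((ρ : ℂ) * exp ((y : ℂ) * I)) / (1 - (ρ : ℂ) * exp ((y : ℂ) * I))).re =
        (ρ * Real.cos y - ρ ^ 2) / (1 - 2 * ρ * Real.cos y + ρ ^ 2) ∧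
      (((ρ : ℂ) * exp ((y : ℂ) * I)) / (1 - (ρ : ℂ) * exp ((y : ℂ) * I))).im =
        ρ * Real.sin y / (1 - 2 * ρ * Real.cos y + ρ ^ 2) := by
  set z : ℂ := (ρ : ℂ) * exp ((y : ℂ) * I) with hz
  have hzre : z.re = ρ * Real.cos y := by
    simp [hz, Complex.mul_re, Complex.exp_ofReal_mul_I_re, Complex.exp_ofReal_mul_I_im]
  have hzim : z.im = ρ * Real.sin y := by
    simp [hz, Complex.mul_im, Complex.exp_ofReal_mul_I_re, Complex.exp_ofReal_mul_I_im]
  have hwre : (1 - z).re = 1 - ρ * Real.cos y := by simp [hzre]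
  have hwim : (1 - z).im = -(ρ * Real.sin y) := by simp [hzim]
  have hD : Complex.normSq (1 - z) = 1 - 2 * ρ * Real.cos y + ρ ^ 2 := by
    rw [Complex.normSq_apply, hwre, hwim]
    have := Real.sin_sq_add_cos_sq y
    nlinarith [this]
  have hDpos : 0 < 1 - 2 * ρ * Real.cos y + ρ ^ 2 := poissonDenom_pos hρ y
  refine ⟨?_, ?_⟩
  · rw [Complex.div_re, hD, hzre, hzim, hwre, hwim, ← add_div]
    congr 1
    have := Real.sin_sq_add_cos_sq y
    linear_combination (-(ρ ^ 2)) * this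
  · rw [Complex.div_im, hD, hzre, hzim, hwre, hwim, ← sub_div]
    congr 1
    ring

/-- The two geometric Fourier series in closed form: for `|ρ| < 1`,
`Σ_{k≥0} ρ^{k+1} cos((k+1)y) = (ρ cos y − ρ²)/(1 − 2ρ cos y + ρ²)` and `Σ_{k≥0} ρ^{k+1} sin((k+1)y) = ρ sin y/(1 − 2ρ cos y + ρ²)`.
[cite: Grafakos2014, Ex. 4.1.4 (Fourier series of the Poisson / conjugate Poisson kernel)] -/
theorem hasSum_geometric_cos_sin {ρ : ℝ} (hρ : |ρ| < 1) (y : ℝ) :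
    HasSum (fun k : ℕ => ρ ^ (k + 1) * Real.cos (((k + 1 : ℕ) : ℝ) * y))
        ((ρ * Real.cos y - ρ ^ 2) / (1 - 2 * ρ * Real.cos y + ρ ^ 2)) ∧
      HasSum (fun k : ℕ => ρ ^ (k + 1) * Real.sin (((k + 1 : ℕ) : ℝ) * y))
        (ρ * Real.sin y / (1 - 2 * ρ * Real.cos y + ρ ^ 2)) := by
  set z : ℂ := (ρ : ℂ) * exp ((y : ℂ) * I) with hz
  have hnorm : ‖z‖ < 1 := by
    rw [hz, norm_mul, Complex.norm_real, Complex.norm_exp_ofReal_mul_I, mul_one, Real.norm_eq_abs]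
    exact hρ
  -- Σ z^(k+1) = z/(1 - z)
  have hgeom : HasSum (fun k : ℕ => z ^ (k + 1)) (z / (1 - z)) := by
    have h0 := hasSum_geometric_of_norm_lt_one hnorm
    have h1 : HasSum (fun k : ℕ => z * z ^ k) (z * (1 - z)⁻¹) := h0.mul_left z
    have h2 : (fun k : ℕ => z * z ^ k) = fun k : ℕ => z ^ (k + 1) := by
      funext k; rw [pow_succ']
    rw [h2] at h1
    simpa [div_eq_mul_inv] using h1
  -- termwise real and imaginary parts
  have hterm : ∀ k : ℕ, z ^ (k + 1) = ((ρ ^ (k + 1) : ℝ) : ℂ) * exp (((((k + 1 : ℕ) : ℝ) * y : ℝ) : ℂ) * I) := by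
    intro k
    rw [hz, mul_pow, ← Complex.exp_nat_mul]
    push_cast
    ring_nf
  have hre : ∀ k : ℕ, (z ^ (k + 1)).re = ρ ^ (k + 1) * Real.cos (((k + 1 : ℕ) : ℝ) * y) := by
    intro k
    rw [hterm k, Complex.re_ofReal_mul, Complex.exp_ofReal_mul_I_re]
  have him : ∀ k : ℕ, (z ^ (k + 1)).im = ρ ^ (k + 1) * Real.sin (((k + 1 : ℕ) : ℝ) * y) := by
    intro k
    rw [hterm k, Complex.im_ofReal_mul, Complex.exp_ofReal_mul_I_im]
  obtain ⟨hR, hI⟩ := (Complex.hasSum_iff _ _).mp hgeom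
  obtain ⟨eR, eI⟩ := geometricRatio_re_im hρ y
  have keyR : (z / (1 - z)).re = (ρ * Real.cos y - ρ ^ 2) / (1 - 2 * ρ * Real.cos y + ρ ^ 2) := by
    rw [hz]; exact eR
  have keyI : (z / (1 - z)).im = ρ * Real.sin y / (1 - 2 * ρ * Real.cos y + ρ ^ 2) := by
    rw [hz]; exact eI
  refine ⟨?_, ?_⟩
  · have hfun : (fun k : ℕ => (z ^ (k + 1)).re) = fun k : ℕ => ρ ^ (k + 1) * Real.cos (((k + 1 : ℕ) : ℝ) * y) := by
      funext k; exact hre k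
    rw [hfun, keyR] at hR
    exact hR
  · have hfun : (fun k : ℕ => (z ^ (k + 1)).im) = fun k : ℕ => ρ ^ (k + 1) * Real.sin (((k + 1 : ℕ) : ℝ) * y) := by
      funext k; exact him k
    rw [hfun, keyI] at hI
    exact hI

/-- `P_ρ(y) = 1 + Σ_{k≥0} 2ρ^{k+1} cos((k+1)y)` for `|ρ| < 1`. [cite: Grafakos2014, Ex. 4.1.4] -/
theorem poissonKernelCircle_eq_one_add_tsum {ρ : ℝ} (hρ : |ρ| < 1) (y : ℝ) :
    poissonKernelCircle ρ y = 1 + ∑' k : ℕ, 2 * ρ ^ (k + 1) * Real.cos (((k + 1 : ℕ) : ℝ) * y) := by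
  have h := (hasSum_geometric_cos_sin hρ y).1
  have h2 : HasSum (fun k : ℕ => 2 * ρ ^ (k + 1) * Real.cos (((k + 1 : ℕ) : ℝ) * y))
      (2 * ((ρ * Real.cos y - ρ ^ 2) / (1 - 2 * ρ * Real.cos y + ρ ^ 2))) := by
    have := h.mul_left 2
    simpa [mul_assoc] using this
  rw [h2.tsum_eq, poissonKernelCircle]
  have hD : (1 - 2 * ρ * Real.cos y + ρ ^ 2) ≠ 0 := ne_of_gt (poissonDenom_pos hρ y)
  rw [show (2 : ℝ) * ((ρ * Real.cos y - ρ ^ 2) / (1 - 2 * ρ * Real.cos y + ρ ^ 2)) =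
      (2 * (ρ * Real.cos y - ρ ^ 2)) / (1 - 2 * ρ * Real.cos y + ρ ^ 2) by ring,
    add_div' _ _ _ hD, div_eq_div_iff hD hD]
  ring

/-- `Q_ρ(y) = Σ_{k≥0} 2ρ^{k+1} sin((k+1)y)` for `|ρ| < 1`. [cite: Grafakos2014, Ex. 4.1.4] -/
theorem conjPoissonKernelCircle_eq_tsum {ρ : ℝ} (hρ : |ρ| < 1) (y : ℝ) :
    conjPoissonKernelCircle ρ y = ∑' k : ℕ, 2 * ρ ^ (k + 1) * Real.sin (((k + 1 : ℕ) : ℝ) * y) := by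
  have h := (hasSum_geometric_cos_sin hρ y).2
  have h2 : HasSum (fun k : ℕ => 2 * ρ ^ (k + 1) * Real.sin (((k + 1 : ℕ) : ℝ) * y))
      (2 * (ρ * Real.sin y / (1 - 2 * ρ * Real.cos y + ρ ^ 2))) := by
    have := h.mul_left 2
    simpa [mul_assoc] using this
  rw [h2.tsum_eq, conjPoissonKernelCircle]
  ring

/-! ### `H P_ρ = Q_ρ` -/

/-- Summability weight for the mode-by-mode Hilbert transform: `Σ (k+1)·(|0| + |2ρ^{k+1}|) < ∞` for `|ρ| < 1`. [folklore] -/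
private theorem summable_weight_geometric {ρ : ℝ} (hρ : |ρ| < 1) :
    Summable fun k : ℕ => ((k : ℝ) + 1) * (|(0 : ℝ)| + |2 * ρ ^ (k + 1)|) := by
  have hn : ‖ρ‖ < 1 := by simpa [Real.norm_eq_abs] using hρ
  -- (k+1) ρ^(k+1) is summable (shift of n ρ^n)
  have hs : Summable fun n : ℕ => ((n : ℝ) ^ 1 : ℝ) * ρ ^ n := summable_pow_mul_geometric_of_norm_lt_one 1 hn
  have hs' : Summable fun k : ℕ => (((k + 1 : ℕ) : ℝ) ^ 1) * ρ ^ (k + 1) :=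
    (summable_nat_add_iff 1).mpr hs
  have habs : Summable fun k : ℕ => |(((k + 1 : ℕ) : ℝ) ^ 1) * ρ ^ (k + 1)| := hs'.abs
  refine (habs.mul_left 2).congr fun k => ?_
  rw [abs_zero, zero_add, abs_mul, abs_mul, pow_one, abs_of_nonneg (by positivity : (0 : ℝ) ≤ ((k + 1 : ℕ) : ℝ)),
    abs_of_pos (by norm_num : (0 : ℝ) < 2)]
  push_cast
  ring

/-- **The periodic Hilbert transform of the Poisson kernel is the conjugate Poisson kernel**: `H P_ρ = Q_ρ` (`|ρ| < 1`), i.e. the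
multiplier `−i sgn k` applied to `1 + 2Σ ρᵏ cos ky` gives `2Σ ρᵏ sin ky`. [cite: Grafakos2014, Ex. 4.1.4 (c)] -/
theorem hilbertTransformCircle_poissonKernelCircle {ρ : ℝ} (hρ : |ρ| < 1) (x : ℝ) :
    hilbertTransformCircle (poissonKernelCircle ρ) x = conjPoissonKernelCircle ρ x := by
  -- replace P_ρ by its series; the constant 1 drops out of the symmetric-difference integrand
  have hP : poissonKernelCircle ρ = fun y => 1 + ∑' k : ℕ, 2 * ρ ^ (k + 1) * Real.cos (((k + 1 : ℕ) : ℝ) * y) := by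
    funext y; exact poissonKernelCircle_eq_one_add_tsum hρ y
  have hconst : hilbertTransformCircle (fun y => 1 + ∑' k : ℕ, 2 * ρ ^ (k + 1) * Real.cos (((k + 1 : ℕ) : ℝ) * y)) x =
      hilbertTransformCircle (fun y => ∑' k : ℕ, 2 * ρ ^ (k + 1) * Real.cos (((k + 1 : ℕ) : ℝ) * y)) x := by
    unfold hilbertTransformCircle
    congr 1
    refine intervalIntegral.integral_congr fun t _ => ?_
    simp only
    ring
  rw [hP, hconst]
  -- the mode-by-mode theorem with α = 0, β_k = 2ρ^{k+1}
  have hmodes := hilbertTransformCircle_tsum (α := fun _ => (0 : ℝ)) (β := fun k => 2 * ρ ^ (k + 1))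
    (summable_weight_geometric hρ) x
  simp only [zero_mul, zero_add, neg_zero] at hmodes
  rw [hmodes, conjPoissonKernelCircle_eq_tsum hρ x]

end Literature.Analysis.Fourier
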